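import Summits.Ventures.HodgeRepro2.T6B3Hyp

/-!
# T6B3Main — Tier 6 (README §10), sub-goal B3 IN KERNEL: the automorphic datum ↔ the printed theorem's datum

Proof lane (TARGET-T6.md v0.1 §4 row L2, §7(a)): the top theorem `B3_main` of sub-goal B3 (route/TIER4.md
§B3 = route/T4-B3-p2.md v11.4, THEOREM B3 (i), (iv), (v) and the (iii)-bookkeeping of the inverse types),
proved modulo the displayed published inputs of `T6B3Hyp.lean` (consumed by name) and the B5 interface
Prop `Liu.OscillatorAdmissibleShape K S` (sub-goal B5's output: every admissible oscillator triple has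
non-zero K-invariants at some sufficiently small level — TIER4 §B5 (B5.b)), re-using the ACCEPTED Tier-4
kernel of seat p2 by import (LiuFace.lean p387089: `FaceOscillatorData`, `mult_eq_one`,
`mult_conj_eq_one`, `exists_common_level`, `cmTypeOfImaginary_eq`, `isAdmissible`,
`isWeightOneConjugateSymplectic`; LiuOscillator.lean p386919: `liuMultiplicity`; p1's Faces.lean p386499:
`inverseType`, `isWeilFace_inverseType`).

WHAT IS PROVED (in the words of THEOREM B3): given the sextic-type setting as carriers — a CM number field
`K` Galois over ℚ (= the brief's F; Liu's E), the idèle conjugation `c`, the quadratic character `χEF`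
(= μ_{E/F}), a base embedding `τ₀` (Liu's fixed τ', p. 47 l. 26 = the brief's τ₁), a Weil face `T`
(four CM types, every embedding in exactly two of them = a rank-four face), a finite-order character `χ`
of `E^1\(𝔸_E^∞)^1` (B2(d)'s ν̃, ν = 1 allowed), and Liu's §4.2 datum `S` with n = S.rank ⩾ 3 — there are
four adèlic oscillator triples (μ_i, ε_i, χ) with
(i)   μ_i conjugate symplectic of weight one with CM type Φ_{μ_i} = T_i^{-1} (`inverseType K τ₀ (T i)`)
      and ε_i μ_i-admissible with the Def. 4.12 witness e_i — VERBATIM the hypotheses «μ is of weight one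
      and ε is μ-admissible» of Prop. 4.13 / Thm. 4.18 / Cor. 4.20 (THEOREM B3(i), from DR15 Lemma 3.5);
(iii) the inverse face (T_i^{-1})_i is again a Weil face and the CM type cut out by e_i is T_i^{-1}
      (the bookkeeping half of THEOREM B3(iii); the F-types of A_{μ_i} ⊗ ℂ need the host carriers);
(iv)  every ω(μ_i, ε_i, χ) and every ω(μ_i^c, −ε_i, χ) occurs in H^1_{B,τ'}(A_∞, ℂ) with multiplicity
      exactly one, for every embedding τ' (THEOREM B3(iv), multiplicity half, from Prop. 4.13);
(v)   there is one sufficiently small level K with ω(μ_i, ε_i, χ)^K ≠ 0, Ω(μ_i)^K ≠ 0 and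
      Hom_E(A_K, A_{μ_i})_ℚ ≠ 0 for ALL FOUR i at once (the φ_i ≠ 0 of THEOREM B3(v) / B7(b), from
      Thm. 4.18 and Thm. 4.18(1) at B5's common level), and at that K the Cor. 4.20 decomposition
      A_K ∼ ∏_μ A_μ^{d(μ,K)} holds with d(μ_i, K) ⩾ 1 and every μ_i orbit-equivalent to a factor's μ.
NOT in this file (declared): the Hodge-type statements of THEOREM B3(ii) and (iv) (eigenlines of A_μ,
H^{1,0} vs H^{0,1} — B4's (b.1)–(b.4) and B3(d), need the host carriers / T6Interface), the F-types of
(iii) and the morphisms f_i of (v) (host carriers). §8(d): uses an L-value-free non-vanishing device: NO.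
-/

namespace Summit.Ventures.HodgeRepro2.T6

open Summit.Ventures.HodgeRepro2 ShimuraData

universe u

/-- THEOREM B3 (i) + (iii)-bookkeeping, DATUM-FREE: from DR15 Lemma 3.5 alone, for every Weil face `T`, every
base embedding `τ₀` and every character `χ` of `E^1\(𝔸_E^∞)^1`, there are four adèlic oscillator triples
(μ_i, ε_i, χ) with Φ_{μ_i} = T_i^{-1} and ε_i μ_i-admissible (`D.weightOne`, `D.admissible`), the inverse face
is again a Weil face, and the Def. 4.12 witness `e_i` cuts out exactly `T_i^{-1}` (TIER4 §B3 B2(b)–(d); the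
hypotheses «μ is of weight one and ε is μ-admissible» of Prop. 4.13 / Thm. 4.18 / Cor. 4.20, verbatim). -/
theorem B3_triples (K : Type u) [Field K] [NumberField K] [NumberField.IsCMField K] [IsGalois ℚ K]
    (c : Liu.IdeleConjugation K) (χEF : Liu.QuadraticCharacter K c)
    (hDR : Hyp.DimitrovRamakrishnan2015_Lemma3_5 K c χEF)
    (τ₀ : K →+* ℂ) (T : Fin 4 → Set (K →+* ℂ)) (hT : IsWeilFace K T)
    (χ : Liu.OneCharacter K c) :
    ∃ D : Liu.FaceOscillatorData K c χEF τ₀ T,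
      (∀ i, (D.vertex i).χ = χ) ∧
      (∀ i, Liu.OscillatorTriple.IsAdmissible K (D.vertex i)) ∧
      (∀ i, Liu.IsWeightOneConjugateSymplectic K c χEF (D.vertex i).μ) ∧
      IsWeilFace K (fun i => inverseType K τ₀ (T i)) ∧
      (∀ i, ShimuraData.cmTypeOfImaginary K (D.vertex i).e = inverseType K τ₀ (T i)) := by
  have hinv : IsWeilFace K (fun i => inverseType K τ₀ (T i)) := isWeilFace_inverseType K τ₀ hT
  have hΦ : ∀ i, IsCMType K (inverseType K τ₀ (T i)) := fun i => hinv.1 i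
  choose μ hμ using fun i => hDR _ (hΦ i)
  choose e he using fun i => Liu.exists_isMuAdmissibleRep K (hΦ i)
  let D : Liu.FaceOscillatorData K c χEF τ₀ T :=
    { face := hT
      vertex := fun i =>
        { μ := μ i, μ_symplectic := (hμ i).1, e := e i, e_mem := (he i).1, χ := χ }
      weightOne := fun i => (hμ i).2
      admissible := fun i => he i }
  exact ⟨D, fun _ => rfl, D.isAdmissible, D.isWeightOneConjugateSymplectic, hinv,
    D.cmTypeOfImaginary_eq⟩

/-- THEOREM B3 in kernel (route/TIER4.md §B3 STATEMENT (i), (iii)-bookkeeping, (iv) multiplicity, (v)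
level-and-Hom), modulo the displayed published inputs (by name) and the B5 interface Prop. -/
theorem B3_main (K : Type u) [Field K] [NumberField K] [NumberField.IsCMField K] [IsGalois ℚ K]
    (c : Liu.IdeleConjugation K) (χEF : Liu.QuadraticCharacter K c)
    (S : Liu.AlbaneseH1Shape K c χEF) (hn : 3 ≤ S.rank)
    (hDR : Hyp.DimitrovRamakrishnan2015_Lemma3_5 K c χEF)
    (h413 : Hyp.Liu2021_Prop4_13 S) (h418 : Hyp.Liu2021_Thm4_18_iso S)
    (h418₁ : Hyp.Liu2021_Thm4_18_1 S) (h420 : Hyp.Liu2021_Cor4_20 S)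
    (hB5 : Liu.OscillatorAdmissibleShape K S)
    (τ₀ : K →+* ℂ) (T : Fin 4 → Set (K →+* ℂ)) (hT : IsWeilFace K T)
    (χ : Liu.OneCharacter K c) :
    ∃ D : Liu.FaceOscillatorData K c χEF τ₀ T,
      -- (i) the third components are the one common character χ (B2(d))
      (∀ i, (D.vertex i).χ = χ) ∧
      -- (i) the hypotheses of Prop. 4.13 / Thm. 4.18 / Cor. 4.20 hold for every vertex triple
      (∀ i, Liu.OscillatorTriple.IsAdmissible K (D.vertex i)) ∧
      (∀ i, Liu.IsWeightOneConjugateSymplectic K c χEF (D.vertex i).μ) ∧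
      -- (iii) the inverse face is a Weil face and e_i cuts out T_i^{-1}
      IsWeilFace K (fun i => inverseType K τ₀ (T i)) ∧
      (∀ i, ShimuraData.cmTypeOfImaginary K (D.vertex i).e = inverseType K τ₀ (T i)) ∧
      -- (iv) multiplicity one at every embedding τ', for the triples and their conjugates
      (∀ (τ' : K →+* ℂ) (i : Fin 4), S.mult τ' (S.osc (D.vertex i)) = 1) ∧
      (∀ (τ' : K →+* ℂ) (i : Fin 4),
        S.mult τ' (S.osc (Liu.OscillatorTriple.conj K (D.vertex i))) = 1) ∧
      -- (v) one common sufficiently small level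
      ∃ L : S.Level, S.IsSmall L ∧
        (∀ i, 0 < S.dimInv (S.osc (D.vertex i)) L) ∧
        (∀ i, 1 ≤ S.omegaInvDim L (D.vertex i).μ) ∧
        (∀ i, 1 ≤ S.homDim L (D.vertex i).μ) ∧
        ∃ (reps : Finset (Liu.AutomorphicCharacter K))
          (Tf : Liu.AutomorphicCharacter K → Finset (Liu.OscillatorTriple K c χEF)),
          (∀ μ ∈ reps, Liu.IsWeightOneConjugateSymplectic K c χEF μ) ∧
          (∀ μ ∈ reps, ∀ μ' ∈ reps, S.galOrbit μ μ' → μ = μ') ∧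
          S.albanese L = ∏ μ ∈ reps, S.cmVariety μ ^ Liu.liuMultiplicity K S (Tf μ) L ∧
          (∀ i, 1 ≤ Liu.liuMultiplicity K S (Tf (D.vertex i).μ) L) ∧
          (∀ i, ∃ μ' ∈ reps, S.galOrbit (D.vertex i).μ μ') := by
  -- (i) + (iii): the four triples, from DR15 Lemma 3.5 (μ_i) and the Def. 4.12 witness (e_i), with χ_i := χ
  obtain ⟨D, hχ, hadm, hwcs, hinv, hcm⟩ := B3_triples K c χEF hDR τ₀ T hT χ
  refine ⟨D, hχ, hadm, hwcs, hinv, hcm, Liu.FaceOscillatorData.mult_eq_one S hn h413 D,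
    Liu.FaceOscillatorData.mult_conj_eq_one S hn h413 D, ?_⟩
  -- (v): the common level from the B5 interface (p2's `exists_common_level`)
  obtain ⟨L, hL, hpos⟩ := Liu.FaceOscillatorData.exists_common_level S hB5 D
  have hΩ : ∀ i, 1 ≤ S.omegaInvDim L (D.vertex i).μ := fun i =>
    (hpos i).trans_le (h418 (D.vertex i) (D.isAdmissible i) L hL)
  have hHom : ∀ i, 1 ≤ S.homDim L (D.vertex i).μ := fun i =>
    (h418₁ (D.vertex i).μ (D.isWeightOneConjugateSymplectic i) L hL) ▸ hΩ i
  obtain ⟨reps, Tf, hreps, -, hcomplete, horbit, hrep, halb⟩ := h420 hn L hL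
  have hd : ∀ i, 1 ≤ Liu.liuMultiplicity K S (Tf (D.vertex i).μ) L := fun i => by
    have hmem : S.osc (D.vertex i) ∈ Finset.image S.osc (Tf (D.vertex i).μ) :=
      hcomplete (D.vertex i).μ (D.vertex i) (D.isAdmissible i) rfl (hpos i)
    exact (hpos i).trans_le
      (Finset.single_le_sum (f := fun π => S.dimInv π L) (fun _ _ => Nat.zero_le _) hmem)
  exact ⟨L, hL, hpos, hΩ, hHom, reps, Tf, hreps, horbit, halb, hd, fun i =>
    hrep (D.vertex i).μ (D.isWeightOneConjugateSymplectic i) (hd i)⟩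

end Summit.Ventures.HodgeRepro2.T6
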